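import Literature.Analysis.Complex.LogTaylorContinuation
import Literature.MathematicalPhysics.QuantumLattice.DWaveSourceLeeYang

/-!
# Cumulant bounds at zero source control the sourced pressure: the Taylor interface

Topic `MathematicalPhysics/QuantumLattice` (companion of `ComplexSourcePartitionFn.lean` and
`DWaveSourceLeeYang.lean`).

For a finite-dimensional Gibbs state with a linear source, `Z(h) = tr e^{-β(H - hQ)}` is entire in the
complex source `h` and the Taylor coefficients at `h = 0` of `log Z`,

  `aₘ = (m!)⁻¹ (log Z)⁽ᵐ⁾(0)`  (`m!·aₘ` = the `m`-th imaginary-time-ordered CUMULANT of `∫₀^β Q(τ)dτ`),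

are the natural output of a perturbative / multiscale analysis of the model AT ZERO SOURCE. This
file records the soft transfer from such cumulant bounds to the sourced pressure, with no a-priori
control of the model at nonzero (or complex) source:

* `partitionFn_sub_smul_ne_zero_of_taylor_bound` — a geometric cumulant bound `‖aₘ‖ ≤ A Bᵐ⁻²`
  (`m ≥ 2`) makes `Z` ZERO-FREE on the complex disc `‖h‖ < 1/B` (a Lee–Yang-free disc from
  cumulants, `LogTaylorContinuation.ne_zero_of_taylor_bound`);
* **`abs_log_partitionFn_sub_smul_sub_le_of_taylor_bound`** — if moreover `Z` is even in the source
  (e.g. by a grading, `partitionFn_sub_neg_smul_eq_of_grading`), then for real `s` with `B|s| ≤ 1/2`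
  `|log Z(H - sQ) - log Z(H)| ≤ 2A s²`;
* the `d`-wave–sourced Hubbard torus (`dWaveSourceTorus`, even in the source by the gauge rotation,
  `partitionFn_hubbardTorusWith_sub_neg_smul_pairSource`):
  `partitionFn_dWaveSource_ne_zero_of_taylor_bound` (zero-free source disc) and
  **`dWaveSource_abs_sourcedGain_le_of_taylor_bound`** —
  `|p̃_L(s) - p̃_L(0)| ≤ 2A s²/(βL²)` for `B|s| ≤ 1/2`, `p̃_L = log Z_L/(βL²)`.
  With the expected Fermi-liquid sizes `A = C(1 + log β)·βL²`, `B = C'β` of the pair-field cumulants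
  this is the thermal-disc bound `p̃_L(s) - p̃_L(0) ≤ 2C(1 + log β)s²`, `|s| ≤ 1/(2C'β)`, of the crux
  `TwSourcedInertness` of `HubbardSuperconductivity/ThermalWedge` — read off ZERO-SOURCE data of the
  interacting model only.

Everything is PROVED; no definition is introduced.

## References

* D. Ruelle, *Statistical Mechanics: Rigorous Results* (1969), §4.4 (zeros of the partition function,
  analyticity of the pressure). [Ruelle1969]
* T. Koma, H. Tasaki, J. Stat. Phys. 76 (1994) 745, §1 (order-parameter source). [KomaTasaki1994]
-/

noncomputable section

open scoped Matrix.Norms.L2Operator ComplexOrder Nat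
open Matrix Complex Literature.Probability.LatticeModels

namespace Literature.MathematicalPhysics.QuantumLattice

section General

variable {n : Type*} [Fintype n] [DecidableEq n]

/-- The partition function of a Hermitian Hamiltonian lies in the slit plane (it is a positive
real). [folklore] -/
theorem partitionFn_mem_slitPlane (β : ℝ) {H : Matrix n n ℂ} (hH : H.IsHermitian) [Nonempty n] :
    partitionFn β H ∈ slitPlane :=
  mem_slitPlane_iff.mpr (Or.inl (Complex.pos_iff.1 (partitionFn_pos β hH)).1)

/-- An even sourced partition function has `Z'(0) = 0`. [folklore] -/
theorem deriv_partitionFn_sub_smul_eq_zero_of_even (β : ℝ) (H Q : Matrix n n ℂ)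
    (heven : ∀ h : ℂ, partitionFn β (H - (-h) • Q) = partitionFn β (H - h • Q)) :
    deriv (fun h : ℂ => partitionFn β (H - h • Q)) 0 = 0 := by
  set F : ℂ → ℂ := fun h => partitionFn β (H - h • Q) with hF
  have hFe : (fun h => F (-h)) = F := funext fun h => heven h
  have h1 : deriv (fun h => F (-h)) 0 = -deriv F (-0) := deriv_comp_neg F 0
  rw [hFe, neg_zero] at h1
  linear_combination h1 / 2

omit [Fintype n] [DecidableEq n] in
/-- A radius strictly between `‖z‖` and `1/B`. [folklore] -/
theorem exists_norm_lt_and_mul_lt_one {B : ℝ} (hB : 0 ≤ B) {z : ℂ} (hz : B * ‖z‖ < 1) :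
    ∃ r : ℝ, ‖z‖ < r ∧ B * r < 1 := by
  rcases eq_or_lt_of_le hB with hB0 | hBpos
  · exact ⟨‖z‖ + 1, by linarith, by rw [← hB0]; simp⟩
  · have hzB : ‖z‖ < B⁻¹ := by
      refine lt_of_mul_lt_mul_left ?_ hBpos.le
      rwa [mul_inv_cancel₀ hBpos.ne']
    refine ⟨(‖z‖ + B⁻¹) / 2, by linarith, ?_⟩
    have h1 : B * ((‖z‖ + B⁻¹) / 2) = (B * ‖z‖ + B * B⁻¹) / 2 := by ring
    rw [h1, mul_inv_cancel₀ hBpos.ne']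
    linarith

/-- **A Lee–Yang-free disc from cumulant bounds.** If the Taylor coefficients of `log Z` at zero
source satisfy `‖(m!)⁻¹(log Z)⁽ᵐ⁾(0)‖ ≤ A Bᵐ⁻²` for `m ≥ 2`, then `Z(h) = tr e^{-β(H - hQ)} ≠ 0` for
every complex source with `B‖h‖ < 1` (Hermitian `H`, any `Q`). [cite: Ruelle1969, §4.4] -/
theorem partitionFn_sub_smul_ne_zero_of_taylor_bound (β : ℝ) {H : Matrix n n ℂ}
    (hH : H.IsHermitian) [Nonempty n] (Q : Matrix n n ℂ) {A B : ℝ} (hA : 0 ≤ A) (hB : 0 ≤ B)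
    (hK : ∀ m : ℕ, 2 ≤ m →
      ‖((m ! : ℂ))⁻¹ * iteratedDeriv m (fun h : ℂ => log (partitionFn β (H - h • Q))) 0‖ ≤
        A * B ^ (m - 2))
    {h : ℂ} (hh : B * ‖h‖ < 1) : partitionFn β (H - h • Q) ≠ 0 := by
  obtain ⟨r, hzr, hBr⟩ := exists_norm_lt_and_mul_lt_one hB hh
  have h0 : (fun h : ℂ => partitionFn β (H - h • Q)) 0 ∈ slitPlane := by
    simpa using partitionFn_mem_slitPlane β hH
  exact Literature.Analysis.Complex.ne_zero_of_taylor_bound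
    (differentiable_partitionFn_sub_smul β H Q) h0 hA hB hK
    (lt_of_le_of_lt (norm_nonneg _) hzr) hBr hzr

/-- **Cumulant bounds at zero source bound the sourced pressure gain.** Let `H, Q` be Hermitian on a
nonempty finite-dimensional system and suppose `Z(h) = tr e^{-β(H - hQ)}` is even in the complex
source. If the Taylor coefficients of `log Z` at `0` satisfy `‖(m!)⁻¹(log Z)⁽ᵐ⁾(0)‖ ≤ A Bᵐ⁻²` for
`m ≥ 2`, then for every real `s` with `B|s| ≤ 1/2`:
`|log Z(H - sQ) - log Z(H)| ≤ 2A s²`. [cite: Ruelle1969, §4.4] -/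
theorem abs_log_partitionFn_sub_smul_sub_le_of_taylor_bound (β : ℝ) {H Q : Matrix n n ℂ}
    (hH : H.IsHermitian) (hQ : Q.IsHermitian) [Nonempty n]
    (heven : ∀ h : ℂ, partitionFn β (H - (-h) • Q) = partitionFn β (H - h • Q))
    {A B : ℝ} (hA : 0 ≤ A) (hB : 0 ≤ B)
    (hK : ∀ m : ℕ, 2 ≤ m →
      ‖((m ! : ℂ))⁻¹ * iteratedDeriv m (fun h : ℂ => log (partitionFn β (H - h • Q))) 0‖ ≤
        A * B ^ (m - 2))
    {s : ℝ} (hs : B * |s| ≤ 1 / 2) :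
    |Real.log (partitionFn β (H - (s : ℂ) • Q)).re - Real.log (partitionFn β H).re| ≤
      2 * A * s ^ 2 := by
  set F : ℂ → ℂ := fun h => partitionFn β (H - h • Q) with hF
  have hFd : Differentiable ℂ F := differentiable_partitionFn_sub_smul β H Q
  have hF0 : F 0 = partitionFn β H := by simp [hF]
  have h0 : F 0 ∈ slitPlane := by
    rw [hF0]; exact partitionFn_mem_slitPlane β hH
  have h1 : deriv F 0 = 0 := deriv_partitionFn_sub_smul_eq_zero_of_even β H Q heven
  have hs' : B * ‖(s : ℂ)‖ ≤ 1 / 2 := by rwa [Complex.norm_real, Real.norm_eq_abs]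
  have hmain := Literature.Analysis.Complex.abs_log_norm_sub_le_two_mul_of_deriv_eq_zero
    hFd h0 h1 hA hB hK hs'
  have hHs : (H - (s : ℂ) • Q).IsHermitian := hH.sub (isHermitian_real_smul hQ s)
  have hns : ‖F (s : ℂ)‖ = (partitionFn β (H - (s : ℂ) • Q)).re :=
    norm_eq_re_of_pos (partitionFn_pos β hHs)
  have hn0 : ‖F 0‖ = (partitionFn β H).re := by
    rw [hF0]; exact norm_eq_re_of_pos (partitionFn_pos β hH)
  rw [hns, hn0, Complex.norm_real, Real.norm_eq_abs, sq_abs] at hmain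
  exact hmain

end General

/-! ### The `d`-wave–sourced Hubbard torus -/

section Torus

variable (L : ℕ) [NeZero L]

/-- **Zero-free source disc of the torus from pair-field cumulant bounds.** If the Taylor
coefficients at `h = 0` of `log Z_L(h)`, `Z_L(h) = tr e^{-β(H - h(Δ_d + Δ_d†))}`,
`H = hubbardTorusWith 2 L 1 U μ`, obey `‖(m!)⁻¹(log Z_L)⁽ᵐ⁾(0)‖ ≤ A Bᵐ⁻²` for `m ≥ 2`, then
`Z_L(h) ≠ 0` for every complex `h` with `B‖h‖ < 1`. [cite: Ruelle1969, §4.4] -/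
theorem partitionFn_dWaveSource_ne_zero_of_taylor_bound (β U μ : ℝ) {A B : ℝ} (hA : 0 ≤ A)
    (hB : 0 ≤ B)
    (hK : ∀ m : ℕ, 2 ≤ m →
      ‖((m ! : ℂ))⁻¹ * iteratedDeriv m (fun z : ℂ => log (partitionFn β (hubbardTorusWith 2 L 1 U μ -
        z • (pairField dWaveFormFactor L + (pairField dWaveFormFactor L)ᴴ)))) 0‖ ≤ A * B ^ (m - 2))
    {h : ℂ} (hh : B * ‖h‖ < 1) :
    partitionFn β (hubbardTorusWith 2 L 1 U μ -
        h • (pairField dWaveFormFactor L + (pairField dWaveFormFactor L)ᴴ)) ≠ 0 :=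
  partitionFn_sub_smul_ne_zero_of_taylor_bound β
    (isHermitian_hamiltonianWith (fermionTorusGraph 2 L) 1 U μ) _ hA hB hK hh

/-- **Pair-field cumulant bounds at zero source bound the sourced `d`-wave pressure gain of the
torus.** If the Taylor coefficients at `h = 0` of `log Z_L(h)` (`Z_L` as above, even in `h` by the
gauge rotation) obey `‖(m!)⁻¹(log Z_L)⁽ᵐ⁾(0)‖ ≤ A Bᵐ⁻²` for `m ≥ 2`, then for every real `s` with
`B|s| ≤ 1/2`, with `p̃_L(s) = log Z_β(dWaveSourceTorus L U μ s)/(βL²)` and `β > 0`: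
`|p̃_L(s) - p̃_L(0)| ≤ 2A s²/(βL²)`. (With `A = C(1 + log β)βL²`, `B = C'β` this is the thermal-disc
bound `≤ 2C(1 + log β)s²` on `|s| ≤ 1/(2C'β)`.) [cite: Ruelle1969, §4.4] -/
theorem dWaveSource_abs_sourcedGain_le_of_taylor_bound {β : ℝ} (hβ : 0 < β) (U μ : ℝ) {A B : ℝ}
    (hA : 0 ≤ A) (hB : 0 ≤ B)
    (hK : ∀ m : ℕ, 2 ≤ m →
      ‖((m ! : ℂ))⁻¹ * iteratedDeriv m (fun z : ℂ => log (partitionFn β (hubbardTorusWith 2 L 1 U μ -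
        z • (pairField dWaveFormFactor L + (pairField dWaveFormFactor L)ᴴ)))) 0‖ ≤ A * B ^ (m - 2))
    {s : ℝ} (hs : B * |s| ≤ 1 / 2) :
    |Real.log (partitionFn β (dWaveSourceTorus L U μ s)).re / (β * (L : ℝ) ^ 2) -
        Real.log (partitionFn β (dWaveSourceTorus L U μ 0)).re / (β * (L : ℝ) ^ 2)| ≤
      2 * A * s ^ 2 / (β * (L : ℝ) ^ 2) := by
  set H := hubbardTorusWith 2 L 1 U μ with hH
  set Q := pairField dWaveFormFactor L + (pairField dWaveFormFactor L)ᴴ with hQ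
  have hHh : H.IsHermitian := isHermitian_hamiltonianWith (fermionTorusGraph 2 L) 1 U μ
  have hQh : Q.IsHermitian := isHermitian_pairField_add_conjTranspose L
  have h0 : dWaveSourceTorus L U μ 0 = H := dWaveSourceTorus_zero L U μ
  have hs' : dWaveSourceTorus L U μ s = H - (s : ℂ) • Q := rfl
  have hmain := abs_log_partitionFn_sub_smul_sub_le_of_taylor_bound β hHh hQh
    (partitionFn_hubbardTorusWith_sub_neg_smul_pairSource L β U μ) hA hB hK hs
  rw [h0, hs']
  have hL : (0 : ℝ) < (L : ℝ) ^ 2 := by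
    have : (0 : ℝ) < L := Nat.cast_pos.2 (Nat.pos_of_ne_zero (NeZero.ne L))
    positivity
  have hβL : 0 < β * (L : ℝ) ^ 2 := mul_pos hβ hL
  rw [← sub_div, abs_div, abs_of_pos hβL, div_le_div_iff_of_pos_right hβL]
  exact hmain

/-- One-sided form of `dWaveSource_abs_sourcedGain_le_of_taylor_bound`:
`p̃_L(s) - p̃_L(0) ≤ 2A s²/(βL²)` for `B|s| ≤ 1/2`. [cite: Ruelle1969, §4.4] -/
theorem dWaveSource_sourcedGain_le_of_taylor_bound {β : ℝ} (hβ : 0 < β) (U μ : ℝ) {A B : ℝ}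
    (hA : 0 ≤ A) (hB : 0 ≤ B)
    (hK : ∀ m : ℕ, 2 ≤ m →
      ‖((m ! : ℂ))⁻¹ * iteratedDeriv m (fun z : ℂ => log (partitionFn β (hubbardTorusWith 2 L 1 U μ -
        z • (pairField dWaveFormFactor L + (pairField dWaveFormFactor L)ᴴ)))) 0‖ ≤ A * B ^ (m - 2))
    {s : ℝ} (hs : B * |s| ≤ 1 / 2) :
    Real.log (partitionFn β (dWaveSourceTorus L U μ s)).re / (β * (L : ℝ) ^ 2) -
        Real.log (partitionFn β (dWaveSourceTorus L U μ 0)).re / (β * (L : ℝ) ^ 2) ≤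
      2 * A * s ^ 2 / (β * (L : ℝ) ^ 2) :=
  (le_abs_self _).trans (dWaveSource_abs_sourcedGain_le_of_taylor_bound L hβ U μ hA hB hK hs)

end Torus

end Literature.MathematicalPhysics.QuantumLattice
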